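import Literature.AlgebraicGeometry.Modules.CechTheta
import HarnessLib

/-!
# The Čech cup product with a `1`-cocycle of local homomorphisms, and `[ω] ∘ [α] = [ω ∪ α]` on `Ext`

For a scheme `X`, a family of opens `𝓤 = (U_i)`, `𝒪_X`-modules `E, M, N` and a `1`-COCYCLE of local
homomorphisms `α = (α_{ab} : M|_{U_{ab}} → N|_{U_{ab}})` (`Cech.LocalFamily`, `dα = 0`;
`Modules/CechTheta.lean`), the **cup product with `α` on the back edge**

  `(s ∪ α)_{i₀…i_{n+1}} = α_{i_n i_{n+1}}(s_{i₀…i_n}|)`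

is a degree-one map of sheaf Čech complexes `ψ_n = cupMap α n : Čⁿ(𝓤, M) → Čⁿ⁺¹(𝓤, N)` commuting
with the differentials (`d_comp_cupMap`: the graded Leibniz rule `d(s ∪ α) = ds ∪ α ± s ∪ dα` with
`dα = 0`), with `ε ≫ ψ₀ = α♯` (`augment_comp_cupMap`) and `ω♯ ≫ ψ_n = (ω ∪ α)♯` for a cochain of local
homomorphisms `ω : E|_{U_α} → M|_{U_α}` and the composite family
`(ω ∪ α)_{i₀…i_{n+1}} = ω_{i₀…i_n}| ≫ α_{i_n i_{n+1}}|` (`cupFamily`, `familyHom_comp_cupMap`). Hence, by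
the abstract cup-product compatibility of the iterated connecting classes
(`ExactAugmentation.theta_comp_degOne`, `Literature/Algebra/Homology/IteratedExtClass.lean`),
**the Yoneda composite of Čech classes is the Čech class of the cup product**:

  `Cech.classOf a' (ω ∪ α) = (Cech.classOf a ω).comp (Cech.classOf a' α)`  (`classOf_cupFamily`)

in `Extⁿ⁺¹(E, N)` (Godement II.6: cup product of Čech cochains; its agreement with the Yoneda
product). Used to compute `σ₁ = Tr(− ∘ At(E))` of a Čech obstruction class as the class of the Čech
`3`-cocycle `ω ∪ {dT}`. Everything is proved; no named facts.

## References

* R. Godement, *Topologie algébrique et théorie des faisceaux* (1958), II.6 (cup product).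
* R. Hartshorne, *Algebraic Geometry*, GTM 52 (1977), III.4. [Hartshorne1977]
-/

noncomputable section

universe u

open CategoryTheory CategoryTheory.Abelian AlgebraicGeometry Opposite TopologicalSpace Limits

namespace Literature.AlgebraicGeometry.Modules

namespace Cech

variable {X : Scheme.{u}} {ι : Type u} {U : ι → X.Opens} {E M N : X.Modules}

/-! ### Front face and back edge of a simplex -/

/-- The back edge `(i_n, i_{n+1})` of an `(n+1)`-simplex `(i₀, …, i_{n+1})`. [folklore] -/
def back (n : ℕ) (γ : Fin (n + 2) → ι) : Fin 2 → ι := fun j => γ (Fin.natAdd n j)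

/-- The front face `(i₀, …, i_n)` of an `(n+1)`-simplex. [folklore] -/
def front {n : ℕ} (γ : Fin (n + 2) → ι) : Fin (n + 1) → ι := γ ∘ Fin.castSucc

variable (U) in
/-- `U_γ ≤ U_{back γ}`. [folklore] -/
lemma face_le_face_back (n : ℕ) (γ : Fin (n + 2) → ι) : face U γ ≤ face U (back n γ) :=
  face_le_face_comp U γ (Fin.natAdd n)

variable (U) in
/-- `U_γ ≤ U_{front γ}`. [folklore] -/
lemma face_le_face_front {n : ℕ} (γ : Fin (n + 2) → ι) : face U γ ≤ face U (front γ) :=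
  face_le_face_comp U γ Fin.castSucc

/-! ### Index identities -/

/-- Deleting a non-final vertex commutes with taking the front face:
`δ_{castSucc k} ∘ castSucc = castSucc ∘ δ_k`. [folklore] -/
lemma succAbove_castSucc_comp_castSucc {n : ℕ} (k : Fin (n + 2)) :
    (Fin.succAbove (Fin.castSucc k)) ∘ (Fin.castSucc : Fin (n + 1) → Fin (n + 2)) =
      Fin.castSucc ∘ Fin.succAbove k := by
  funext i
  change Fin.succAbove (Fin.castSucc k) (Fin.castSucc i) = Fin.castSucc (Fin.succAbove k i)
  by_cases h : Fin.castSucc i < k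
  · rw [Fin.succAbove_of_castSucc_lt _ _ h, Fin.succAbove_of_castSucc_lt]
    exact Fin.castSucc_lt_castSucc_iff.mpr h
  · rw [not_lt] at h
    rw [Fin.succAbove_of_le_castSucc _ _ h, Fin.succAbove_of_le_castSucc, Fin.succ_castSucc]
    exact Fin.castSucc_le_castSucc_iff.mpr h

/-- Deleting a vertex of the front face does not move the back edge. [folklore] -/
lemma succAbove_castSucc_castSucc_natAdd {n : ℕ} (k : Fin (n + 1)) (j : Fin 2) :
    Fin.succAbove (Fin.castSucc (Fin.castSucc k)) (Fin.natAdd n j) = Fin.natAdd (n + 1) j := by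
  rw [Fin.succAbove_of_le_castSucc]
  · ext; simp only [Fin.val_succ, Fin.val_natAdd]; omega
  · rw [Fin.le_def]; simp only [Fin.val_castSucc, Fin.val_natAdd]; omega

/-- Front face after deleting the vertex `castSucc k`. [folklore] -/
lemma front_comp_succAbove_castSucc {n : ℕ} (γ : Fin (n + 3) → ι) (k : Fin (n + 2)) :
    front (γ ∘ Fin.succAbove (Fin.castSucc k)) = front γ ∘ Fin.succAbove k := by
  change γ ∘ (Fin.succAbove (Fin.castSucc k) ∘ Fin.castSucc) = (γ ∘ Fin.castSucc) ∘ Fin.succAbove k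
  rw [succAbove_castSucc_comp_castSucc]
  rfl

/-- Back edge after deleting a vertex of the front face. [folklore] -/
lemma back_comp_succAbove_castSucc_castSucc {n : ℕ} (γ : Fin (n + 3) → ι) (k : Fin (n + 1)) :
    back n (γ ∘ Fin.succAbove (Fin.castSucc (Fin.castSucc k))) = back (n + 1) γ := by
  funext j
  change γ (Fin.succAbove _ (Fin.natAdd n j)) = γ (Fin.natAdd (n + 1) j)
  rw [succAbove_castSucc_castSucc_natAdd]

/-- The three vertices `(i_n, i_{n+1}, i_{n+2})` of an `(n+2)`-simplex. [folklore] -/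
def backThree (n : ℕ) (γ : Fin (n + 3) → ι) : Fin 3 → ι := fun j => γ (Fin.natAdd n j)

/-- Face `0` of the back triangle is the back edge. [folklore] -/
lemma backThree_comp_succAbove_zero {n : ℕ} (γ : Fin (n + 3) → ι) :
    backThree n γ ∘ Fin.succAbove 0 = back (n + 1) γ := by
  funext j
  change γ (Fin.natAdd n (Fin.succAbove 0 j)) = γ (Fin.natAdd (n + 1) j)
  congr 1; ext
  simp only [Fin.succAbove_zero, Fin.val_natAdd, Fin.val_succ]; omega

/-- Face `1` of the back triangle is the back edge of the simplex with vertex `n + 1` deleted.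
[folklore] -/
lemma backThree_comp_succAbove_one {n : ℕ} (γ : Fin (n + 3) → ι) :
    backThree n γ ∘ Fin.succAbove 1 = back n (γ ∘ Fin.succAbove (Fin.castSucc (Fin.last (n + 1)))) := by
  funext j
  change γ (Fin.natAdd n (Fin.succAbove 1 j)) =
    γ (Fin.succAbove (Fin.castSucc (Fin.last (n + 1))) (Fin.natAdd n j))
  congr 1
  fin_cases j
  · rw [Fin.succAbove_of_castSucc_lt _ (Fin.natAdd n _)]
    · ext; simp
    · rw [Fin.lt_def]; simp
  · rw [Fin.succAbove_of_le_castSucc _ (Fin.natAdd n _)]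
    · ext; simp
    · rw [Fin.le_def]; simp

/-- Face `2` of the back triangle is the back edge of the simplex with the last vertex deleted.
[folklore] -/
lemma backThree_comp_succAbove_two {n : ℕ} (γ : Fin (n + 3) → ι) :
    backThree n γ ∘ Fin.succAbove 2 = back n (γ ∘ Fin.succAbove (Fin.last (n + 2))) := by
  funext j
  rw [Fin.succAbove_last]
  change γ (Fin.natAdd n (Fin.succAbove 2 j)) = γ (Fin.castSucc (Fin.natAdd n j))
  congr 1
  have h0 : Fin.succAbove (2 : Fin 3) (0 : Fin 2) = 0 := by decide
  have h1 : Fin.succAbove (2 : Fin 3) (1 : Fin 2) = 1 := by decide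
  fin_cases j
  · ext; simp [h0]
  · ext; simp [h1]

/-- The front face of the front face is the front face after deleting the last vertex. [folklore] -/
lemma front_comp_succAbove_last {n : ℕ} (γ : Fin (n + 3) → ι) :
    front (γ ∘ Fin.succAbove (Fin.last (n + 2))) = front γ ∘ Fin.succAbove (Fin.last (n + 1)) := by
  rw [Fin.succAbove_last, Fin.succAbove_last]
  rfl

/-- … and also after deleting the vertex `n + 1`. [folklore] -/
lemma front_comp_succAbove_castSucc_last {n : ℕ} (γ : Fin (n + 3) → ι) :
    front (γ ∘ Fin.succAbove (Fin.castSucc (Fin.last (n + 1)))) =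
      front γ ∘ Fin.succAbove (Fin.last (n + 1)) :=
  front_comp_succAbove_castSucc γ (Fin.last (n + 1))

variable (U) in
/-- `U_γ ≤ U_{backThree γ}`. [folklore] -/
lemma face_le_face_backThree {n : ℕ} (γ : Fin (n + 3) → ι) : face U γ ≤ face U (backThree n γ) :=
  face_le_face_comp U γ (Fin.natAdd n)

/-! ### Values of families at propositionally equal simplices -/

/-- Values of a cochain of local homomorphisms at propositionally equal simplices agree.
[folklore] -/
lemma appLE_family_congr {n : ℕ} (ω : LocalFamily U n E M) {β β' : Fin (n + 1) → ι}
    (h : β = β') {W : X.Opens} (k : W ⟶ face U β) (k' : W ⟶ face U β') (x : Γ(E, W)) :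
    appLE (ω β) k x = appLE (ω β') k' x := by
  subst h; rw [Subsingleton.elim k k']

/-- Integer multiples pass through values of local homomorphisms. [folklore] -/
lemma appLE_zsmul_right {W V : X.Opens} (φ : E.over W ⟶ M.over W) (k : V ⟶ W) (z : ℤ)
    (s : Γ(E, V)) : appLE φ k (z • s) = z • appLE φ k s :=
  map_zsmul (φ.val.app (op (Over.mk k))).hom z s

/-! ### The cup product with a `1`-cochain -/

variable (α : LocalFamily U 1 M N)

/-- **The cup product with `α` on sections**: `(s ∪ α)_γ = α_{back γ}(s_{front γ}|_{V ⊓ U_γ})`.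
[folklore] -/
def cupSections (n : ℕ) (V : X.Opens) (s : Sections U n M V) : Sections U (n + 1) N V := fun γ =>
  appLE (α (back n γ)) (homOfLE (inf_le_right.trans (face_le_face_back U n γ)))
    (res M (inf_le_inf_left V (face_le_face_front U γ)) (s (front γ)))

/-- `cupSections` is additive. [folklore] -/
lemma cupSections_add (n : ℕ) (V : X.Opens) (s t : Sections U n M V) :
    cupSections α n V (s + t) = cupSections α n V s + cupSections α n V t := by
  funext γ
  simp only [cupSections, add_apply, map_add, appLE_add_right]

/-- `cupSections` is `𝒪(V)`-linear. [folklore] -/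
lemma cupSections_smul (n : ℕ) (V : X.Opens) (r : Γ(X, V)) (s : Sections U n M V) :
    cupSections α n V (r • s) = r • cupSections α n V s := by
  funext γ
  simp only [cupSections, smul_apply, res_smul, appLE_smul_right, resO_resO]

/-- `cupSections` is compatible with restriction. [folklore] -/
lemma cupSections_restrict (n : ℕ) {V W : X.Opens} (h : W ≤ V) (s : Sections U n M V) :
    cupSections α n W (restrict U n M h s) = restrict U (n + 1) N h (cupSections α n V s) := by
  funext γ
  simp only [cupSections, restrict_apply, res_res]
  rw [← res_res (inf_le_inf_left V (face_le_face_front U γ)) (inf_le_inf_right (face U γ) h)]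
  exact appLE_map (α (back n γ)) (homOfLE _) (homOfLE _) _

/-- **The cup product with a `1`-cochain of local homomorphisms**
`ψ_n = (– ∪ α) : Čⁿ(𝓤, M) → Čⁿ⁺¹(𝓤, N)`. [folklore] -/
def cupMap (n : ℕ) : obj U n M ⟶ obj U (n + 1) N :=
  homMk (cupSections α n) (cupSections_add α n) (cupSections_smul α n)
    (fun _ _ i s => cupSections_restrict α n i.le s)

/-- Components of the cup product. [folklore] -/
@[simp] lemma cupMap_app_apply (n : ℕ) (V : X.Opens) (s : Γ(obj U n M, V)) (γ : Fin (n + 2) → ι) :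
    ((cupMap α n).app V s : Sections U (n + 1) N V) γ =
      appLE (α (back n γ)) (homOfLE (inf_le_right.trans (face_le_face_back U n γ)))
        (res M (inf_le_inf_left V (face_le_face_front U γ)) ((s : Sections U n M V) (front γ))) :=
  rfl

/-- **`ε ≫ ψ₀ = α♯`**: `(ε m ∪ α)_{ab} = α_{ab}(m|)`. [folklore] -/
theorem augment_comp_cupMap : augment U M ≫ cupMap α 0 = familyHom α := by
  refine hom_ext_to fun V m β => ?_
  rw [Scheme.Modules.Hom.comp_app, CategoryTheory.comp_apply, cupMap_app_apply, familyHom_app_apply,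
    augment_app_apply, res_res]
  have hβ : back 0 β = β := by
    funext j; change β (Fin.natAdd 0 j) = β j; congr 1; ext; simp
  exact appLE_family_congr α hβ _ _ _

/-- **The cup product of a cochain of local homomorphisms with `α`**:
`(ω ∪ α)_γ = ω_{front γ}| ≫ α_{back γ}|`. [folklore] -/
def cupFamily {n : ℕ} (ω : LocalFamily U n E M) : LocalFamily U (n + 1) E N := fun γ =>
  restrictHom (homOfLE (face_le_face_front U γ)) (ω (front γ)) ≫
    restrictHom (homOfLE (face_le_face_back U n γ)) (α (back n γ))

/-- Values of the cup family. [folklore] -/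
lemma appLE_cupFamily {n : ℕ} (ω : LocalFamily U n E M) (γ : Fin (n + 2) → ι) {W : X.Opens}
    (k : W ⟶ face U γ) (x : Γ(E, W)) :
    appLE (cupFamily α ω γ) k x =
      appLE (α (back n γ)) (k ≫ homOfLE (face_le_face_back U n γ))
        (appLE (ω (front γ)) (k ≫ homOfLE (face_le_face_front U γ)) x) := rfl

/-- Moving a restriction inside a value: `(φ_k s)|_{W'} = φ_{l ≫ k}(s|_{W'})` for `res`. [folklore] -/
lemma res_appLE {W W' V : X.Opens} (φ : E.over V ⟶ M.over V) (k : W ⟶ V) (h : W' ≤ W) (s : Γ(E, W)) :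
    res M h (appLE φ k s) = appLE φ (homOfLE h ≫ k) (res E h s) :=
  (appLE_map φ k (homOfLE h) s).symm

/-- **`ω♯ ≫ ψ_n = (ω ∪ α)♯`.** [folklore] -/
theorem familyHom_comp_cupMap {n : ℕ} (ω : LocalFamily U n E M) :
    familyHom ω ≫ cupMap α n = familyHom (cupFamily α ω) := by
  refine hom_ext_to fun V x γ => ?_
  rw [Scheme.Modules.Hom.comp_app, CategoryTheory.comp_apply, cupMap_app_apply, familyHom_app_apply,
    familyHom_app_apply, appLE_cupFamily, res_appLE, res_res]
  rw [appLE_congr_hom (ω (front γ)) _ (homOfLE inf_le_right ≫ homOfLE (face_le_face_front U γ))]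
  exact appLE_congr_hom _ _ _ _

/-! ### The cup product commutes with the differentials -/

/-- The cocycle condition of `α` in applied form: `α_{bc}(x) - α_{ac}(x) + α_{ab}(x) = 0` for the
three faces of a triangle `τ = (a, b, c)` and `x ∈ Γ(M, W)`, `W ≤ U_τ`, with arbitrary names for
the inclusions. [folklore] -/
lemma cocycle_apply (hα : dFamily α = 0) (τ : Fin 3 → ι) {W : X.Opens} (k : W ⟶ face U τ)
    (k₀ : W ⟶ face U (τ ∘ Fin.succAbove 0)) (k₁ : W ⟶ face U (τ ∘ Fin.succAbove 1))
    (k₂ : W ⟶ face U (τ ∘ Fin.succAbove 2)) (x : Γ(M, W)) :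
    appLE (α (τ ∘ Fin.succAbove 0)) k₀ x - appLE (α (τ ∘ Fin.succAbove 1)) k₁ x +
      appLE (α (τ ∘ Fin.succAbove 2)) k₂ x = 0 := by
  have h := congrArg (fun φ => appLE φ k x) (congrFun hα τ)
  simp only [Pi.zero_apply, appLE_zero] at h
  rw [dFamily, appLE_sum, Fin.sum_univ_three, appLE_zsmul, appLE_zsmul, appLE_zsmul,
    appLE_restrictHom, appLE_restrictHom, appLE_restrictHom] at h
  simp only [Fin.val_zero, pow_zero, one_smul, Fin.val_one, pow_one, neg_one_zsmul, Fin.val_two,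
    neg_one_sq] at h
  rw [appLE_congr_hom (α (τ ∘ Fin.succAbove 0)) k₀ (k ≫ homOfLE (face_le_face_comp U τ _)),
    appLE_congr_hom (α (τ ∘ Fin.succAbove 1)) k₁ (k ≫ homOfLE (face_le_face_comp U τ _)),
    appLE_congr_hom (α (τ ∘ Fin.succAbove 2)) k₂ (k ≫ homOfLE (face_le_face_comp U τ _)),
    sub_eq_add_neg]
  exact h

/-- The generic term `α_β(s_δ|)` over `W ≤ V` (names of inclusions irrelevant). [folklore] -/
lemma term_congr {n : ℕ} {V W : X.Opens} (s : Sections U n M V) {β β' : Fin 2 → ι} (hβ : β = β')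
    {δ δ' : Fin (n + 1) → ι} (hδ : δ = δ') (k : W ⟶ face U β) (k' : W ⟶ face U β')
    (h : W ≤ V ⊓ face U δ) (h' : W ≤ V ⊓ face U δ') :
    appLE (α β) k (res M h (s δ)) = appLE (α β') k' (res M h' (s δ')) := by
  subst hβ hδ; rw [Subsingleton.elim k k']

/-- **The cup product with a `1`-cocycle commutes with the Čech differentials**:
`d(s ∪ α) = (ds) ∪ α` (graded Leibniz with `dα = 0`; the two extra terms of `d(s ∪ α)` and the last
term of `(ds) ∪ α` are the three faces of the cocycle identity on the back triangle).
[folklore] -/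
theorem d_comp_cupMap (hα : dFamily α = 0) (n : ℕ) :
    d U M n ≫ cupMap α (n + 1) = cupMap α n ≫ d U N (n + 1) := by
  refine hom_ext_to fun V s γ => ?_
  rw [Scheme.Modules.Hom.comp_app, CategoryTheory.comp_apply, cupMap_app_apply, d_app_apply,
    Scheme.Modules.Hom.comp_app, CategoryTheory.comp_apply, d_app_apply]
  -- the generic term
  set s' : Sections U n M V := s with hs'
  -- LHS : `α_{back γ}( (Σ_k (-1)^k s_{front γ ∘ δ_k}|)| )`, push the sum out
  rw [map_sum, appLE_sum_right]
  simp only [map_zsmul, appLE_zsmul_right, res_res, cupMap_app_apply]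
  -- RHS : `Σ_{k : Fin (n+3)} (-1)^k (α_{back(γ∘δ_k)} (s_{front(γ∘δ_k)}|))|`, move `res` inside
  simp only [res_appLE, res_res]
  -- split the sums: LHS over `Fin (n+2) = castSucc (Fin (n+1)) ∪ {last}`,
  -- RHS over `Fin (n+3) = castSucc (castSucc (Fin (n+1))) ∪ {castSucc last} ∪ {last}`
  conv_lhs => rw [Fin.sum_univ_castSucc]
  conv_rhs => rw [Fin.sum_univ_castSucc]; rw [Fin.sum_univ_castSucc]
  simp only [Fin.val_castSucc, Fin.val_last]
  -- the main sums agree termwise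
  have hmain : ∀ k : Fin (n + 1),
      appLE (α (back (n + 1) γ)) (homOfLE (inf_le_right.trans (face_le_face_back U (n + 1) γ)))
        (res M ((inf_le_inf_left V (face_le_face_front U γ)).trans
          (inf_le_inf_left V (face_le_face_comp U (front γ) (Fin.succAbove (Fin.castSucc k)))))
          (s' (front γ ∘ Fin.succAbove (Fin.castSucc k)))) =
      appLE (α (back n (γ ∘ Fin.succAbove (Fin.castSucc (Fin.castSucc k)))))
        (homOfLE (inf_le_inf_left V (face_le_face_comp U γ (Fin.succAbove _))) ≫
          homOfLE (inf_le_right.trans (face_le_face_back U n _)))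
        (res M ((inf_le_inf_left V (face_le_face_comp U γ (Fin.succAbove _))).trans
          (inf_le_inf_left V (face_le_face_front U _)))
          (s' (front (γ ∘ Fin.succAbove (Fin.castSucc (Fin.castSucc k)))))) := fun k =>
    term_congr α s' (back_comp_succAbove_castSucc_castSucc γ k).symm
      (front_comp_succAbove_castSucc γ (Fin.castSucc k)).symm _ _ _ _
  simp only [hmain]
  refine Eq.trans ?_ (add_assoc _ _ _).symm
  congr 1
  -- the three remaining terms: x := s_{γ₀…γ_n}| , the cocycle identity on the back triangle
  have e1 := term_congr α s' (backThree_comp_succAbove_zero γ).symm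
    (show front γ ∘ Fin.succAbove (Fin.last (n + 1)) = front γ ∘ Fin.succAbove (Fin.last (n + 1))
      from rfl)
    (homOfLE (inf_le_right.trans (face_le_face_back U (n + 1) γ)))
    (homOfLE (inf_le_right.trans ((face_le_face_backThree U γ).trans
      (face_le_face_comp U _ (Fin.succAbove 0)))))
    ((inf_le_inf_left V (face_le_face_front U γ)).trans
      (inf_le_inf_left V (face_le_face_comp U (front γ) (Fin.succAbove (Fin.last (n + 1))))))
    ((inf_le_inf_left V (face_le_face_front U γ)).trans
      (inf_le_inf_left V (face_le_face_comp U (front γ) (Fin.succAbove (Fin.last (n + 1))))))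
  have e2 := term_congr α s' (backThree_comp_succAbove_one γ)
    (front_comp_succAbove_castSucc_last γ).symm
    (homOfLE (inf_le_right.trans ((face_le_face_backThree U γ).trans
      (face_le_face_comp U _ (Fin.succAbove 1)))))
    (homOfLE (inf_le_inf_left V (face_le_face_comp U γ (Fin.succAbove _))) ≫
      homOfLE (inf_le_right.trans (face_le_face_back U n _)))
    ((inf_le_inf_left V (face_le_face_front U γ)).trans
      (inf_le_inf_left V (face_le_face_comp U (front γ) (Fin.succAbove (Fin.last (n + 1))))))
    ((inf_le_inf_left V (face_le_face_comp U γ (Fin.succAbove _))).trans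
      (inf_le_inf_left V (face_le_face_front U _)))
  have e3 := term_congr α s' (backThree_comp_succAbove_two γ)
    (front_comp_succAbove_last γ).symm
    (homOfLE (inf_le_right.trans ((face_le_face_backThree U γ).trans
      (face_le_face_comp U _ (Fin.succAbove 2)))))
    (homOfLE (inf_le_inf_left V (face_le_face_comp U γ (Fin.succAbove _))) ≫
      homOfLE (inf_le_right.trans (face_le_face_back U n _)))
    ((inf_le_inf_left V (face_le_face_front U γ)).trans
      (inf_le_inf_left V (face_le_face_comp U (front γ) (Fin.succAbove (Fin.last (n + 1))))))
    ((inf_le_inf_left V (face_le_face_comp U γ (Fin.succAbove _))).trans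
      (inf_le_inf_left V (face_le_face_front U _)))
  rw [← e2, ← e3, e1]
  have hc := cocycle_apply α hα (backThree n γ)
    (homOfLE (inf_le_right.trans (face_le_face_backThree U γ)))
    (homOfLE (inf_le_right.trans ((face_le_face_backThree U γ).trans
      (face_le_face_comp U _ (Fin.succAbove 0)))))
    (homOfLE (inf_le_right.trans ((face_le_face_backThree U γ).trans
      (face_le_face_comp U _ (Fin.succAbove 1)))))
    (homOfLE (inf_le_right.trans ((face_le_face_backThree U γ).trans
      (face_le_face_comp U _ (Fin.succAbove 2)))))
    (res M ((inf_le_inf_left V (face_le_face_front U γ)).trans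
      (inf_le_inf_left V (face_le_face_comp U (front γ) (Fin.succAbove (Fin.last (n + 1))))))
      (s' (front γ ∘ Fin.succAbove (Fin.last (n + 1)))))
  -- signs: `(-1)^{n+1} A₀ = (-1)^{n+1} A₁ + (-1)^{n+2} A₂` with `A₀ - A₁ + A₂ = 0`
  rw [pow_succ (-1 : ℤ) (n + 1)]
  set c : ℤ := (-1) ^ (n + 1)
  rw [mul_neg_one, neg_smul, ← sub_eq_add_neg, ← smul_sub]
  congr 1
  rw [eq_sub_iff_add_eq]
  rwa [sub_add_eq_add_sub, sub_eq_zero] at hc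

/-- The cup product as a degree-one map between the Čech COMPLEXES (same data as `cupMap`, typed
on `(Cech.complex 𝓤 M).X n`, the shape consumed by `ExactAugmentation.theta_comp_degOne`). [folklore] -/
abbrev cupMapX (n : ℕ) : (complex U M).X n ⟶ (complex U N).X (n + 1) := cupMap α n

/-- The cup product commutes with the differentials of `Cech.complex`. [folklore] -/
theorem complex_d_comp_cupMap (hα : dFamily α = 0) (n : ℕ) :
    (complex U M).d n (n + 1) ≫ cupMapX α (n + 1) = cupMapX α n ≫ (complex U N).d (n + 1) (n + 1 + 1) := by
  rw [complex_d, complex_d]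
  exact d_comp_cupMap α hα n

/-! ### `[ω] ∘ [α] = [ω ∪ α]` -/

/-- **`ω ↦ ω♯` is injective**: a family whose morphism `E → Čⁿ(𝓤, M)` vanishes is zero (evaluate
the `γ`-component on sections over opens `W ≤ U_γ`, where `W ⊓ U_γ = W`). [folklore] -/
theorem eq_zero_of_familyHom_eq_zero {n : ℕ} {ω : LocalFamily U n E M} (h : familyHom ω = 0) : ω = 0 := by
  funext γ
  apply hom_ext_of_appLE
  intro W k x
  have hγ := congrArg (fun φ : E ⟶ obj U n M => ((φ.app W x : Sections U n M W) γ)) h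
  simp only [familyHom_app_apply, Scheme.Modules.Hom.zero_app] at hγ
  change appLE (ω γ) (homOfLE inf_le_right) (res E inf_le_left x) = (0 : Sections U n M W) γ at hγ
  rw [zero_apply] at hγ
  have h₁ : W ⊓ face U γ ≤ W := inf_le_left
  have hW : W ≤ W ⊓ face U γ := le_inf le_rfl k.le
  have e : appLE (ω γ) k x = res M hW (res M h₁ (appLE (ω γ) k x)) := by rw [res_res, res_self]
  rw [Pi.zero_apply, appLE_zero, e, res_appLE, appLE_congr_hom (ω γ) _ (homOfLE inf_le_right), hγ,
    map_zero]

/-- The cup family of cocycles is a cocycle. [folklore] -/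
theorem dFamily_cupFamily (hα : dFamily α = 0) {n : ℕ} (ω : LocalFamily U n E M) (hω : dFamily ω = 0) :
    dFamily (cupFamily α ω) = 0 := by
  apply eq_zero_of_familyHom_eq_zero
  rw [← familyHom_comp_d, ← familyHom_comp_cupMap, Category.assoc, ← d_comp_cupMap α hα n,
    ← Category.assoc, familyHom_comp_d, hω, familyHom_zero, zero_comp]

variable [HasExt.{u + 1} X.Modules]

/-- **The Yoneda composite of Čech classes is the Čech class of the cup product**:
`[ω ∪ α] = [ω] ∘ [α] ∈ Extⁿ⁺¹(E, N)` for an `n`-cocycle `ω` of local homomorphisms `E → M` and a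
`1`-cocycle `α` of local homomorphisms `M → N`, the classes being taken with respect to exact
augmentations `a` of `Č•(𝓤, M)` (compatible with `Cech.augment`) and `a'` of `Č•(𝓤, N)`.
[cite: Hartshorne1977, III.4] -/
theorem classOf_cupFamily (a : Literature.Algebra.Homology.ExactAugmentation (complex U M) M)
    (a' : Literature.Algebra.Homology.ExactAugmentation (complex U N) N) (ha : a.ε = augment U M)
    (hα : dFamily α = 0) {n : ℕ} (ω : LocalFamily U n E M) (hω : dFamily ω = 0) :
    classOf a' (cupFamily α ω) (dFamily_cupFamily α hα ω hω) =
      (classOf a ω hω).comp (classOf a' α hα) rfl := by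
  have h := a.theta_comp_degOne a' (cupMapX α) (complex_d_comp_cupMap α hα) (familyHom ω)
    (familyHom_comp_d_eq_zero ω hω)
    (Literature.Algebra.Homology.ExactAugmentation.comp_ψ_d_eq_zero (cupMapX α)
      (complex_d_comp_cupMap α hα) (familyHom ω) (familyHom_comp_d_eq_zero ω hω))
  rw [classOf_def, classOf_def, classOf_def,
    a'.theta_congr (familyHom_comp_cupMap α ω).symm _
      (Literature.Algebra.Homology.ExactAugmentation.comp_ψ_d_eq_zero (cupMapX α)
        (complex_d_comp_cupMap α hα) (familyHom ω) (familyHom_comp_d_eq_zero ω hω))]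
  have h2 : a'.theta (a.ε ≫ cupMapX α 0)
      (Literature.Algebra.Homology.ExactAugmentation.ε_ψ_d a (cupMapX α) (complex_d_comp_cupMap α hα)) =
      a'.theta (familyHom α) (familyHom_comp_d_eq_zero α hα) :=
    a'.theta_congr (by rw [ha]; exact augment_comp_cupMap α) _ _
  rw [h2] at h
  exact h

end Cech

end Literature.AlgebraicGeometry.Modules

end
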